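import Literature.Topology.FourManifolds.CappellShanesonClassNumberTwoUnits
import Literature.LinearAlgebra.Matrix.LatimerMacDuffeeIdeal
import HarnessLib

/-!
# Two conjugacy classes of Cappell–Shaneson matrices of trace `-5`:
# `aitchisonRubinstein1984_traceNegFiveClasses` discharged

Fourth and last file of the discharge of the named fact
`Literature.Topology.FourManifolds.aitchisonRubinstein1984_traceNegFiveClasses` of
`CappellShanesonTraceClasses.lean`: "There are two conjugacy classes of Cappell-Shaneson matrices
with trace `-5`, represented by `A₋₇` and `B = !![0, -5, -8; 0, 2, 3; 1, 0, -7]`" (Gompf, Algebr.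
Geom. Topol. 10 (2010), Examples 3.1(b), from Aitchison–Rubinstein, Contemp. Math. 35 (1984),
Appendix, Table 1 and Example `a = -5`), i.e. every `A ∈ SL(3, ℤ)` with `det (A - I) = 1` and
`tr A = -5` is conjugate to `A₋₇` or to `B`, and these two are not conjugate.

## The proof (Latimer–MacDuffee–Taussky and class number two)

Let `f = f₋₅ = x³ + 5x² - 6x - 1`, `S = ℤ[X]/(f) = ℤ[θ]`, `𝔭₅ = (5, θ - 2) ⊆ S`.

* A Cappell–Shaneson matrix `A` of trace `-5` has characteristic polynomial `f`
  (`charpoly_eq_csPoly`), so `ℤ³` is an `S`-module `ℤ³_A` (`QuotModule`), isomorphic to a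
  non-zero ideal `J ⊆ S` (Taussky's Theorem 1, `QuotModule.exists_linearEquiv_ideal`).
* `S ≅ 𝓞 K` for the cubic field `K = ℚ[x]/(f)` (`exists_ringEquiv_adjoinRoot_of_sq`), whose
  ideal classes are `1` and `[𝔭₅]` (`classGroup_mem_pair_negFive`); transported back
  (`ideal_class_adjoinRoot_negFive`), `(x) J = (y) S` or `(x) J = (y) 𝔭₅`, so `J ≅ S` or `J ≅ 𝔭₅`
  as `S`-modules (`linearEquivOfSpanSingletonMulEq`).
* Explicitly, `ℤ³_{A₋₇} ≅ S` via the basis `(θ - 1, 1, θ² - θ)` of `S` and `ℤ³_B ≅ 𝔭₅` via the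
  basis `(θ - 2, -5, θ² - 2θ)` of `𝔭₅` (in both cases `θ · basis = basis · matrix`;
  `quotModule_A7_equiv`, `quotModule_B_equiv`). Hence `ℤ³_A ≅ ℤ³_{A₋₇}` or `ℤ³_A ≅ ℤ³_B`, and
  isomorphic modules are conjugate matrices (Taussky's Theorems 2–3,
  `QuotModule.exists_isUnit_det_of_linearEquiv`; `GL` versus `SL` conjugacy by
  `isConj_iff_exists_isUnit_det`): the first conjunct.
* If `A₋₇` and `B` were conjugate, `S ≅ ℤ³_{A₋₇} ≅ ℤ³_B ≅ 𝔭₅` (`QuotModule.linearEquivOfConj`)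
  would make `𝔭₅` principal (`ideal_eq_span_of_linearEquiv`), contradicting class number two
  (`not_isPrincipal_P5_negFive`, transported: `not_isPrincipal_p5_adjoinRoot_negFive`): the second
  conjunct.

## References

* [GompfAGT2010] R. E. Gompf, *More Cappell–Shaneson spheres are standard*, Algebr. Geom. Topol.
  10 (2010) 1665–1681, §3 ("conjugacy classes … corresponding bijectively to ideal classes of
  `ℤ[θ]`") and Examples 3.1(b).
* [AitchisonRubinstein1984] I. R. Aitchison, J. H. Rubinstein, Contemp. Math. 35 (1984), Appendix
  "Conjugacy in `SL(3, ℤ)`", Theorem (Newman), Table 1 (row `a = -5`), Example `a = -5`.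
* [Taussky1949] O. Taussky, Canad. J. Math. 1 (1949) 300–302, Theorems 1–3.
-/

noncomputable section

open Set Polynomial Module NumberField Ideal
open scoped NumberField MatrixGroups
open Literature.LinearAlgebra.Matrix

namespace Literature.Topology.FourManifolds

/-- The cubic relation `θ³ + 5θ² - 6θ - 1 = 0` in `ℤ[X]/(f₋₅)`. [folklore] -/
theorem root_rel_negFive :
    AdjoinRoot.root (csPoly (-5)) ^ 3 + 5 * AdjoinRoot.root (csPoly (-5)) ^ 2 -
      6 * AdjoinRoot.root (csPoly (-5)) - 1 = 0 := by
  have hp : csPoly (-5) = X ^ 3 + 5 * X ^ 2 - 6 * X - 1 := by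
    simp only [csPoly, map_neg, map_sub, map_one, map_ofNat]
    ring
  have h : aeval (AdjoinRoot.root (csPoly (-5))) (X ^ 3 + 5 * X ^ 2 - 6 * X - 1 : ℤ[X]) = 0 := by
    rw [← hp, AdjoinRoot.aeval_eq, AdjoinRoot.mk_self]
  have h' : aeval (AdjoinRoot.root (csPoly (-5))) (X ^ 3 + 5 * X ^ 2 - 6 * X - 1 : ℤ[X]) =
      AdjoinRoot.root (csPoly (-5)) ^ 3 + 5 * AdjoinRoot.root (csPoly (-5)) ^ 2 -
        6 * AdjoinRoot.root (csPoly (-5)) - 1 := by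
    simp only [map_sub, map_add, map_mul, map_pow, aeval_X, map_ofNat, map_one]
  rw [h'] at h
  exact h

/-! ### The ideal classes of `ℤ[X]/(f₋₅)`, transported from `𝓞 K` -/

/-- **The ideal classes of `S = ℤ[X]/(f₋₅)`**: every non-zero ideal `J` of `S` satisfies
`(x) J = (y) S` or `(x) J = (y) 𝔭₅`, `𝔭₅ = (5, θ - 2)`, for some non-zero `x, y ∈ S`
(transport of `classGroup_mem_pair_negFive` along `S ≅ 𝓞 K`, `K = ℚ[x]/(f₋₅)`). [cite: AitchisonRubinstein1984, Appendix, Table 1 (row a = -5) and Example a = -5] -/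
theorem ideal_class_adjoinRoot_negFive (J : Ideal (AdjoinRoot (csPoly (-5)))) (hJ : J ≠ ⊥) :
    ∃ x y : AdjoinRoot (csPoly (-5)), x ≠ 0 ∧ y ≠ 0 ∧
      (span {x} * J = span {y} * ⊤ ∨
        span {x} * J = span {y} * span {(5 : AdjoinRoot (csPoly (-5))),
          AdjoinRoot.root (csPoly (-5)) - 2}) := by
  classical
  set θ' := AdjoinRoot.root (csPolyQ (-5)) with hθ'
  have hθ : aeval θ' (csPoly (-5)) = 0 := aeval_root_csPoly (-5)
  have h3 : finrank ℚ (CSField (-5)) = 3 := finrank_CSField (-5)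
  obtain ⟨e, he⟩ := exists_ringEquiv_adjoinRoot_of_sq hθ h3 csDisc_negFive_sq
  set I : Ideal (𝓞 (CSField (-5))) := J.map e with hI
  have hIJ : I.map (e.symm : 𝓞 (CSField (-5)) →+* AdjoinRoot (csPoly (-5))) = J := by
    rw [hI]
    exact Ideal.map_of_equiv e (I := J)
  have hI0 : I ≠ ⊥ := by
    intro h0
    apply hJ
    rw [← hIJ, h0, Ideal.map_bot]
  have hImem : I ∈ nonZeroDivisors (Ideal (𝓞 (CSField (-5)))) :=
    mem_nonZeroDivisors_iff_ne_zero.mpr hI0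
  -- the image of `𝔭₅` under `e.symm`
  have hsymm : ∀ x, (e.symm : 𝓞 (CSField (-5)) →+* AdjoinRoot (csPoly (-5))) (e x) = x :=
    fun x => e.symm_apply_apply x
  have hP5 : (span {(5 : 𝓞 (CSField (-5))), thetaInt hθ - 2}).map
      (e.symm : 𝓞 (CSField (-5)) →+* AdjoinRoot (csPoly (-5))) =
      span {(5 : AdjoinRoot (csPoly (-5))), AdjoinRoot.root (csPoly (-5)) - 2} := by
    rw [Ideal.map_span, Set.image_insert_eq, Set.image_singleton, map_sub, ← he, hsymm, map_ofNat,
      map_ofNat]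
  rcases classGroup_mem_pair_negFive hθ h3 (ClassGroup.mk0 ⟨I, hImem⟩) with h1 | h5
  · -- principal
    obtain ⟨z, hz⟩ := ((ClassGroup.mk0_eq_one_iff hImem).mp h1).principal
    have hz' : I = span {z} := by rw [hz, submodule_span_eq]
    have hz0 : z ≠ 0 := by
      rintro rfl
      apply hI0
      rw [hz', Ideal.span_singleton_eq_bot]
    refine ⟨1, (e.symm : 𝓞 (CSField (-5)) →+* AdjoinRoot (csPoly (-5))) z, one_ne_zero,
      (map_ne_zero_iff _ e.symm.injective).mpr hz0, Or.inl ?_⟩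
    rw [Ideal.span_singleton_one, Ideal.top_mul, Ideal.mul_top, ← hIJ, hz', Ideal.map_span,
      Set.image_singleton]
  · -- the class of `𝔭₅`
    obtain ⟨x, y, hx, hy, hxy⟩ := ClassGroup.mk0_eq_mk0_iff.mp h5
    refine ⟨(e.symm : 𝓞 (CSField (-5)) →+* AdjoinRoot (csPoly (-5))) x,
      (e.symm : 𝓞 (CSField (-5)) →+* AdjoinRoot (csPoly (-5))) y,
      (map_ne_zero_iff _ e.symm.injective).mpr hx, (map_ne_zero_iff _ e.symm.injective).mpr hy,
      Or.inr ?_⟩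
    have h := congrArg (Ideal.map (e.symm : 𝓞 (CSField (-5)) →+* AdjoinRoot (csPoly (-5)))) hxy
    simp only [Ideal.map_mul, Ideal.map_span, Set.image_singleton] at h
    rw [hIJ] at h
    rw [h, ← hP5, Ideal.map_span]

/-- **`𝔭₅ = (5, θ - 2) ⊆ ℤ[X]/(f₋₅)` is not principal** (transport of
`not_isPrincipal_P5_negFive`: class number two). [cite: AitchisonRubinstein1984, Appendix, Table 1 (row a = -5)] -/
theorem not_isPrincipal_p5_adjoinRoot_negFive :
    ¬ (span {(5 : AdjoinRoot (csPoly (-5))), AdjoinRoot.root (csPoly (-5)) - 2}).IsPrincipal := by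
  intro hprinc
  set θ' := AdjoinRoot.root (csPolyQ (-5)) with hθ'
  have hθ : aeval θ' (csPoly (-5)) = 0 := aeval_root_csPoly (-5)
  have h3 : finrank ℚ (CSField (-5)) = 3 := finrank_CSField (-5)
  obtain ⟨e, he⟩ := exists_ringEquiv_adjoinRoot_of_sq hθ h3 csDisc_negFive_sq
  apply not_isPrincipal_P5_negFive hθ h3
  obtain ⟨z, hz⟩ := hprinc.principal
  have hmap : (span {(5 : AdjoinRoot (csPoly (-5))), AdjoinRoot.root (csPoly (-5)) - 2}).map
      (e : AdjoinRoot (csPoly (-5)) →+* 𝓞 (CSField (-5))) =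
      span {(5 : 𝓞 (CSField (-5))), thetaInt hθ - 2} := by
    rw [Ideal.map_span, Set.image_insert_eq, Set.image_singleton, map_sub, map_ofNat, map_ofNat,
      RingEquiv.coe_toRingHom, he]
  rw [← hmap, hz, submodule_span_eq, Ideal.map_span, Set.image_singleton]
  exact ⟨⟨e z, by rw [submodule_span_eq]; rfl⟩⟩

/-! ### The modules of `A₋₇` and `B` -/

/-- A Cappell–Shaneson matrix of trace `-5` is annihilated by `f₋₅` (Cayley–Hamilton,
`charpoly_eq_csPoly`). [cite: AitchisonRubinstein1984, Appendix, Theorem A3] -/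
theorem aeval_csPoly_negFive (A : SL(3, ℤ)) (hdet : ((A : Matrix (Fin 3) (Fin 3) ℤ) - 1).det = 1)
    (htr : Matrix.trace (A : Matrix (Fin 3) (Fin 3) ℤ) = -5) :
    aeval (A : Matrix (Fin 3) (Fin 3) ℤ) (csPoly (-5)) = 0 := by
  rw [← htr]
  exact aeval_csPoly_eq_zero A hdet

/-- `f₋₅(A₋₇) = 0`. [cite: GompfAGT2010, Examples 3.1(b)] -/
theorem aeval_csPoly_A7 :
    aeval (cappellShanesonMatrix (-7) : Matrix (Fin 3) (Fin 3) ℤ) (csPoly (-5)) = 0 :=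
  aeval_csPoly_negFive _ (det_cappellShanesonMatrix_sub_one (-7))
    (by rw [trace_coe_cappellShanesonMatrix]; norm_num)

/-- `f₋₅(B) = 0`. [cite: GompfAGT2010, Examples 3.1(b)] -/
theorem aeval_csPoly_B :
    aeval (gompfTraceNegFiveMatrix : Matrix (Fin 3) (Fin 3) ℤ) (csPoly (-5)) = 0 :=
  aeval_csPoly_negFive _ det_gompfTraceNegFiveMatrix_sub_one trace_coe_gompfTraceNegFiveMatrix

/-- **`ℤ³_{A₋₇} ≅ ℤ[θ]`**: with `β = (θ - 1, 1, θ² - θ)` one has `θ βⱼ = Σᵢ (A₋₇)ᵢⱼ βᵢ`, so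
`v ↦ Σ vⱼ βⱼ` is an `S`-linear map `ℤ³_{A₋₇} → S`, onto (`β₁ = 1`) and injective; i.e. `A₋₇` is
the matrix of multiplication by `θ` on the basis `β` of `ℤ[θ]`, and the ideal class of `A₋₇` is
the principal class. [cite: AitchisonRubinstein1984, Appendix, Example a = -5] -/
theorem quotModule_A7_equiv :
    Nonempty (QuotModule (csPoly (-5)) (cappellShanesonMatrix (-7) : Matrix (Fin 3) (Fin 3) ℤ)
      aeval_csPoly_A7 ≃ₗ[AdjoinRoot (csPoly (-5))] AdjoinRoot (csPoly (-5))) := by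
  set r := AdjoinRoot.root (csPoly (-5)) with hr
  have rel := root_rel_negFive
  rw [← hr] at rel
  let β : Fin 3 → AdjoinRoot (csPoly (-5)) := ![r - 1, 1, r ^ 2 - r]
  have hβ : ∀ j, r * β j =
      ∑ i, ((cappellShanesonMatrix (-7) : Matrix (Fin 3) (Fin 3) ℤ) i j :
        AdjoinRoot (csPoly (-5))) * β i := by
    intro j
    fin_cases j
    · simp [β, Fin.sum_univ_three, coe_cappellShanesonMatrix]
      ring
    · simp [β, Fin.sum_univ_three, coe_cappellShanesonMatrix]
    · simp [β, Fin.sum_univ_three, coe_cappellShanesonMatrix]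
      linear_combination rel
  haveI : Fact (csPoly (-5)).Monic := ⟨monic_csPoly (-5)⟩
  let g := QuotModule.toRing (hA := aeval_csPoly_A7) β hβ
  have hg1 : g (QuotModule.of _ _ aeval_csPoly_A7 (Pi.single 1 1)) = 1 := by
    change QuotModule.toRing β hβ _ = 1
    rw [QuotModule.toRing_of]
    simp [β, Fin.sum_univ_three]
  have hg0 : g ≠ 0 := by
    intro h
    rw [h, LinearMap.zero_apply] at hg1
    exact zero_ne_one hg1
  have hinj := QuotModule.injective_of_ne_zero (natDegree_csPoly (-5)) (by norm_num) g hg0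
  have hsurj : Function.Surjective g := fun y =>
    ⟨y • QuotModule.of _ _ aeval_csPoly_A7 (Pi.single 1 1), by
      rw [map_smul, hg1, smul_eq_mul, mul_one]⟩
  exact ⟨LinearEquiv.ofBijective g ⟨hinj, hsurj⟩⟩

/-- **`ℤ³_B ≅ 𝔭₅`**: with `β = (θ - 2, -5, θ² - 2θ)` one has `θ βⱼ = Σᵢ Bᵢⱼ βᵢ`, so
`v ↦ Σ vⱼ βⱼ` is an injective `S`-linear map `ℤ³_B → S` with image the ideal
`ℤ(θ - 2) + ℤ·5 + ℤ(θ² - 2θ) = (5, θ - 2) = 𝔭₅`; i.e. `B` is the matrix of multiplication by `θ`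
on a basis of `𝔭₅`, and the ideal class of `B` is `[𝔭₅]` (Aitchison–Rubinstein, Example `a = -5`:
the transpose of `B` "is a representative matrix for the similarity class corresponding to"
the non-trivial class; Gompf, Examples 3.1(b)). [cite: AitchisonRubinstein1984, Appendix, Example a = -5] -/
theorem quotModule_B_equiv :
    Nonempty (QuotModule (csPoly (-5)) (gompfTraceNegFiveMatrix : Matrix (Fin 3) (Fin 3) ℤ)
      aeval_csPoly_B ≃ₗ[AdjoinRoot (csPoly (-5))]
        (span {(5 : AdjoinRoot (csPoly (-5))), AdjoinRoot.root (csPoly (-5)) - 2} :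
          Ideal (AdjoinRoot (csPoly (-5))))) := by
  set r := AdjoinRoot.root (csPoly (-5)) with hr
  have rel := root_rel_negFive
  rw [← hr] at rel
  let β : Fin 3 → AdjoinRoot (csPoly (-5)) := ![r - 2, -5, r ^ 2 - 2 * r]
  have hβ : ∀ j, r * β j =
      ∑ i, ((gompfTraceNegFiveMatrix : Matrix (Fin 3) (Fin 3) ℤ) i j :
        AdjoinRoot (csPoly (-5))) * β i := by
    intro j
    fin_cases j
    · simp [β, Fin.sum_univ_three, coe_gompfTraceNegFiveMatrix]
      ring
    · simp [β, Fin.sum_univ_three, coe_gompfTraceNegFiveMatrix]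
      ring
    · simp [β, Fin.sum_univ_three, coe_gompfTraceNegFiveMatrix]
      linear_combination rel
  haveI : Fact (csPoly (-5)).Monic := ⟨monic_csPoly (-5)⟩
  let g := QuotModule.toRing (hA := aeval_csPoly_B) β hβ
  have hge0 : g (QuotModule.of _ _ aeval_csPoly_B (Pi.single 0 1)) = r - 2 := by
    change QuotModule.toRing β hβ _ = _
    rw [QuotModule.toRing_of]
    simp [β, Fin.sum_univ_three]
  have hge1 : g (QuotModule.of _ _ aeval_csPoly_B (Pi.single 1 1)) = -5 := by
    change QuotModule.toRing β hβ _ = _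
    rw [QuotModule.toRing_of]
    simp [β, Fin.sum_univ_three]
  have h5 : (5 : AdjoinRoot (csPoly (-5))) ≠ 0 := by
    have h := QuotModule.algebraMap_int_ne_zero (f := csPoly (-5)) (natDegree_csPoly (-5))
      (by norm_num) (d := 5) (by norm_num)
    simpa using h
  have hg0 : g ≠ 0 := by
    intro h
    rw [h, LinearMap.zero_apply] at hge1
    exact h5 (by simpa using hge1)
  have hinj := QuotModule.injective_of_ne_zero (natDegree_csPoly (-5)) (by norm_num) g hg0
  have hrange : LinearMap.range g =
      (span {(5 : AdjoinRoot (csPoly (-5))), r - 2} : Ideal (AdjoinRoot (csPoly (-5)))) := by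
    apply le_antisymm
    · rintro _ ⟨m, rfl⟩
      obtain ⟨v, rfl⟩ := (QuotModule.of _ _ aeval_csPoly_B).surjective m
      change QuotModule.toRing β hβ _ ∈ _
      rw [QuotModule.toRing_of]
      simp only [Fin.sum_univ_three, β, Matrix.cons_val_zero, Matrix.cons_val_one,
        Matrix.cons_val_two, Matrix.head_cons, Matrix.tail_cons]
      refine Ideal.add_mem _ (Ideal.add_mem _ ?_ ?_) ?_
      · exact Ideal.mul_mem_left _ _ (Ideal.subset_span (by simp))
      · rw [show (((v 1 : ℤ) : AdjoinRoot (csPoly (-5))) * -5) =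
            (-((v 1 : ℤ) : AdjoinRoot (csPoly (-5)))) * 5 by ring]
        exact Ideal.mul_mem_left _ _ (Ideal.subset_span (by simp))
      · rw [show (((v 2 : ℤ) : AdjoinRoot (csPoly (-5))) * (r ^ 2 - 2 * r)) =
            (((v 2 : ℤ) : AdjoinRoot (csPoly (-5))) * r) * (r - 2) by ring]
        exact Ideal.mul_mem_left _ _ (Ideal.subset_span (by simp))
    · rw [Ideal.span_le]
      rintro z hz
      simp only [Set.mem_insert_iff, Set.mem_singleton_iff] at hz
      rcases hz with rfl | rfl
      · refine ⟨QuotModule.of _ _ aeval_csPoly_B (-Pi.single 1 1), ?_⟩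
        rw [map_neg, map_neg, hge1, neg_neg]
      · exact ⟨QuotModule.of _ _ aeval_csPoly_B (Pi.single 0 1), hge0⟩
  exact ⟨(LinearEquiv.ofInjective g hinj).trans (LinearEquiv.ofEq _ _ hrange)⟩

/-! ### The two conjuncts -/

/-- **Every Cappell–Shaneson matrix of trace `-5` is conjugate to `A₋₇` or to `B`** (Gompf 2010,
Examples 3.1(b): "There are two conjugacy classes of Cappell-Shaneson matrices with trace `-5`,
represented by `A₋₇` and `B`"): its module is isomorphic to an ideal, whose class is `1` or `[𝔭₅]`,
i.e. to the module of `A₋₇` or of `B` (Latimer–MacDuffee–Taussky). [cite: GompfAGT2010, Examples 3.1(b)] [cite: AitchisonRubinstein1984, Appendix (Conjugacy in SL(3,Z)), Table 1 and Example a = -5] -/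
theorem isConj_A7_or_isConj_B (A : SL(3, ℤ)) (hdet : ((A : Matrix (Fin 3) (Fin 3) ℤ) - 1).det = 1)
    (htr : Matrix.trace (A : Matrix (Fin 3) (Fin 3) ℤ) = -5) :
    IsConj (cappellShanesonMatrix (-7)) A ∨ IsConj gompfTraceNegFiveMatrix A := by
  haveI : Fact (csPoly (-5)).Monic := ⟨monic_csPoly (-5)⟩
  have hA := aeval_csPoly_negFive A hdet htr
  obtain ⟨J, hJ, ⟨eJ⟩⟩ := QuotModule.exists_linearEquiv_ideal (f := csPoly (-5))
    (A := (A : Matrix (Fin 3) (Fin 3) ℤ)) (hA := hA) (natDegree_csPoly (-5)) (by norm_num)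
  obtain ⟨x, y, hx, hy, hxy⟩ := ideal_class_adjoinRoot_negFive J hJ
  obtain ⟨e₇⟩ := quotModule_A7_equiv
  obtain ⟨eB⟩ := quotModule_B_equiv
  rcases hxy with h1 | h5
  · left
    let e := eJ.trans ((linearEquivOfSpanSingletonMulEq hx hy h1).trans
      ((Submodule.topEquiv).trans e₇.symm))
    obtain ⟨P, hP, hPA⟩ := QuotModule.exists_isUnit_det_of_linearEquiv e
    exact ((isConj_iff_exists_isUnit_det A _).mpr ⟨P, hP, hPA⟩).symm
  · right
    let e := eJ.trans ((linearEquivOfSpanSingletonMulEq hx hy h5).trans eB.symm)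
    obtain ⟨P, hP, hPA⟩ := QuotModule.exists_isUnit_det_of_linearEquiv e
    exact ((isConj_iff_exists_isUnit_det A _).mpr ⟨P, hP, hPA⟩).symm

/-- **`A₋₇` and `B` are not conjugate** (Gompf 2010, Examples 3.1(b); Aitchison–Rubinstein,
Example `a = -5`): a conjugation would give `ℤ[θ] ≅ ℤ³_{A₋₇} ≅ ℤ³_B ≅ 𝔭₅` as `ℤ[θ]`-modules,
making `𝔭₅` principal, against class number two. [cite: GompfAGT2010, Examples 3.1(b)] [cite: AitchisonRubinstein1984, Appendix, Table 1 (row a = -5) and Example a = -5] -/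
theorem not_isConj_A7_B : ¬ IsConj (cappellShanesonMatrix (-7)) gompfTraceNegFiveMatrix := by
  intro h
  obtain ⟨P, hP, hPAB⟩ := (isConj_iff_exists_isUnit_det _ _).mp h
  let e := QuotModule.linearEquivOfConj (f := csPoly (-5)) (hA := aeval_csPoly_A7)
    (hB := aeval_csPoly_B) P hP hPAB
  obtain ⟨e₇⟩ := quotModule_A7_equiv
  obtain ⟨eB⟩ := quotModule_B_equiv
  let e' := e₇.symm.trans (e.trans eB)
  exact not_isPrincipal_p5_adjoinRoot_negFive
    ⟨⟨(e' 1 : AdjoinRoot (csPoly (-5))), by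
      rw [Ideal.submodule_span_eq]; exact ideal_eq_span_of_linearEquiv e'⟩⟩

/-- **Aitchison–Rubinstein 1984 / Gompf 2010, Examples 3.1(b) — the named fact
`aitchisonRubinstein1984_traceNegFiveClasses` DISCHARGED**: there are exactly two conjugacy classes
of Cappell–Shaneson matrices of trace `-5` in `SL(3, ℤ)`, represented by `A₋₇` and
`!![0, -5, -8; 0, 2, 3; 1, 0, -7]`. [cite: GompfAGT2010, Examples 3.1(b)] [cite: AitchisonRubinstein1984, Appendix (Conjugacy in SL(3,Z)), Table 1 and Example a = -5] -/
theorem aitchisonRubinstein1984_traceNegFiveClasses_holds :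
    aitchisonRubinstein1984_traceNegFiveClasses :=
  ⟨fun A hdet htr => isConj_A7_or_isConj_B A hdet htr, not_isConj_A7_B⟩

end Literature.Topology.FourManifolds

end
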